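/-
Copyright (c) 2026. All rights reserved.
Released under Apache 2.0 license as described in the file LICENSE.
Authors: abc-iut cell, wave-2 seat abc-iut-L3-t11 (proof-only; G10 rung 3b, author's Comments (6)(b) on
[SemiAnbd] Thm 3.7 (iii): from two fixed edges to a fixed branch-pair separating them).
-/
import Literature.AnabelianGeometry.SemiGraphs.TreeFixedBranchPairProofs
import HarnessLib

/-!
# Two fixed edges of a tree: a fixed branch-pair on the geodesic between them, at a jump of any label

Mochizuki, *Semi-graphs of anabelioids*, Publ. RIMS **42** (2006) [MochizukiSemiAnbd2006], Thm 3.7 (iii),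
in the detailed form of the author's *Comments* (2020), (6)(b): "for each `i ≥ j` in `J`, there exists a
pair of distinct edges `e_i, e'_i ∈ E_i` [fixed closed edges of the tree `G_{i,∞}`] whose respective images
`e_{j,i}, e'_{j,i} ∈ E_j` are distinct. By Lemma 1.8, (ii), (b), we may assume without loss of generality that
the pair `{e_i, e'_i}`, hence also the pair `{e_{j,i}, e'_{j,i}}`, forms a subjoint."

The combinatorial content, PROVED here over the Lemma 1.8 (ii)(b) tool files: if a group `Γ` acting on a
tree `G` fixes two edges `e`, `e'`, and a labelling `F` of the edges of `G` (e.g. the edge map of a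
morphism `G → G'`) separates them, `F e ≠ F e'`, then walking along the (pointwise fixed) geodesic of the
subdivision between the two edge-points one finds two CONSECUTIVE edges with different labels: a vertex `v`
with two branches `c ≠ c'` abutting to it, `v, c, c'` fixed by `Γ`, and `F (edgeOf c) ≠ F (edgeOf c')`
(`exists_fixed_branchPair_of_label_ne`). No definitions; nothing specific to anabelioids.
-/

namespace Literature.AnabelianGeometry.SemiGraphs

namespace SemiGraph

open CategoryTheory

universe u

variable {G : SemiGraph.{u}}

/-! ### Walking from an edge-point: four steps -/

section Steps

variable {x y : G.Node} (p : G.subdivision.Walk x y) (hp : p.IsPath)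
include hp

/-- One period of a path of the subdivision starting at an edge-point: `E – c₁ – v – c₂ – E'` with `c₁` a
branch of `E` at `v`, `c₂` a branch at `v` of `E' = edgeOf c₂` (as long as the path is long enough).
[cite: MochizukiSemiAnbd2006, Lem. 1.8(ii)(b) p.20] -/
theorem period_of_edge {k : ℕ} (hk : k + 4 ≤ p.length) {E : G.Edge}
    (hx : p.getVert k = Sum.inr (Sum.inl E)) :
    ∃ (v : G.Vertex) (c₁ c₂ : G.Branch), G.edgeOf c₁ = E ∧ G.abuts c₁ = some v ∧ G.abuts c₂ = some v ∧
      p.getVert (k + 1) = Sum.inr (Sum.inr c₁) ∧ p.getVert (k + 2) = Sum.inl v ∧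
      p.getVert (k + 3) = Sum.inr (Sum.inr c₂) ∧ p.getVert (k + 4) = Sum.inr (Sum.inl (G.edgeOf c₂)) := by
  obtain ⟨c₁, hc₁E, h1⟩ := step_edge p (by omega) hx
  have h2 : ∃ v : G.Vertex, G.abuts c₁ = some v ∧ p.getVert (k + 2) = Sum.inl v := by
    rcases step_branch p (i := k + 1) (by omega) h1 with h | h
    · exact absurd (by rw [h, hx, hc₁E]) (getVert_add_two_ne p hp (i := k) (by omega))
    · exact h
  obtain ⟨v, hc₁v, h2⟩ := h2
  obtain ⟨c₂, hc₂v, h3⟩ := step_vertex p (i := k + 2) (by omega) h2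
  have h4 : p.getVert (k + 4) = Sum.inr (Sum.inl (G.edgeOf c₂)) := by
    rcases step_branch p (i := k + 3) (by omega) h3 with h | ⟨w, hw, h⟩
    · exact h
    · exfalso
      have hwv : w = v := by rw [hc₂v] at hw; simpa using hw.symm
      exact getVert_add_two_ne p hp (i := k + 2) (by omega) (by rw [h, h2, hwv])
  exact ⟨v, c₁, c₂, hc₁E, hc₁v, hc₂v, h1, h2, h3, h4⟩

/-- Along a path of the subdivision starting at an edge-point, every index `4m ≤ length` carries an
edge-point. [cite: MochizukiSemiAnbd2006, Lem. 1.8(ii)(b) p.20] -/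
theorem getVert_four_mul {E₀ : G.Edge} (h0 : p.getVert 0 = Sum.inr (Sum.inl E₀)) :
    ∀ m : ℕ, 4 * m ≤ p.length → ∃ E : G.Edge, p.getVert (4 * m) = Sum.inr (Sum.inl E) := by
  intro m
  induction m with
  | zero => intro _; exact ⟨E₀, by rw [Nat.mul_zero]; exact h0⟩
  | succ m ih =>
    intro hm
    obtain ⟨E, hE⟩ := ih (by omega)
    obtain ⟨v, c₁, c₂, -, -, -, -, -, -, h4⟩ := period_of_edge p hp (k := 4 * m) (by omega) hE
    exact ⟨G.edgeOf c₂, by rw [show 4 * (m + 1) = 4 * m + 4 by ring]; exact h4⟩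

end Steps

/-! ### A discrete intermediate value step -/

/-- If a sequence changes its value between `0` and `N`, it changes at some step `m < N`. [folklore] -/
private theorem exists_step_ne {β : Type*} (a : ℕ → β) {N : ℕ} (h : a 0 ≠ a N) :
    ∃ m, m < N ∧ a m ≠ a (m + 1) := by
  by_contra hall
  push Not at hall
  apply h
  have : ∀ m, m ≤ N → a m = a 0 := by
    intro m
    induction m with
    | zero => intro; rfl
    | succ m ih => intro hm; rw [← hall m (by omega), ih (by omega)]
  exact (this N le_rfl).symm

/-! ### The fixed branch-pair at a jump of the label -/

/-- **Comments (6)(b), the "without loss of generality … forms a subjoint" step**: a group acting on a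
tree and fixing two edges `e`, `e'` separated by a labelling `F` of the edges (`F e ≠ F e'`) fixes a
branch-pair `(v; c ≠ c')` (two consecutive edges of the geodesic between the edge-points, pointwise fixed
by Lemma 1.8 (ii)(b)) at which the label jumps: `F (edgeOf c) ≠ F (edgeOf c')`.
[cite: MochizukiSemiAnbd2006, Thm. 3.7(iii) p.41] -/
theorem exists_fixed_branchPair_of_label_ne {Γ : Type u} [Group Γ] (ρ : Γ →* Aut G) (hG : G.IsTree)
    {β : Type*} (F : G.Edge → β) {e e' : G.Edge} (hF : F e ≠ F e')
    (he : ∀ γ, (ρ γ).hom.edgeMap e = e) (he' : ∀ γ, (ρ γ).hom.edgeMap e' = e') :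
    ∃ (v : G.Vertex) (c c' : G.Branch), c ≠ c' ∧ G.abuts c = some v ∧ G.abuts c' = some v ∧
      F (G.edgeOf c) ≠ F (G.edgeOf c') ∧
      ∀ γ, (ρ γ).hom.vertexMap v = v ∧ (ρ γ).hom.branchMap c = c ∧ (ρ γ).hom.branchMap c' = c' := by
  have hA : G.subdivision.IsAcyclic := hG.isTree.isAcyclic
  have hC : G.subdivision.Connected := hG.isTree.connected
  obtain ⟨p, hp⟩ := hC.exists_isPath (Sum.inr (Sum.inl e) : G.Node) (Sum.inr (Sum.inl e'))
  have fixV : ∀ z ∈ p.support, ∀ γ, nodeMap (ρ γ) z = z := fun z hz γ =>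
    nodeMap_eq_self_of_isPath hA (ρ γ) (by simp [he γ]) (by simp [he' γ]) p hp z hz
  set n := p.length with hn
  -- the edge-points sit at the multiples of `4`; `n` is one of them
  have hedge := getVert_four_mul p hp (E₀ := e) p.getVert_zero
  have hn4 : 4 * (n / 4) = n := by
    -- the last period: positions `4q+1, 4q+2, 4q+3` (as far as they exist) are not edge-points
    obtain ⟨E, hE⟩ := hedge (n / 4) (Nat.mul_div_le n 4)
    have hxn : p.getVert n = Sum.inr (Sum.inl e') := p.getVert_length
    by_contra hne
    have hlt : 4 * (n / 4) < n := lt_of_le_of_ne (Nat.mul_div_le n 4) hne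
    obtain ⟨c₁, hc₁E, h1⟩ := step_edge p hlt hE
    have hr : n = 4 * (n / 4) + 1 ∨ n = 4 * (n / 4) + 2 ∨ n = 4 * (n / 4) + 3 := by omega
    rcases hr with h | h | h
    · rw [h] at hxn; rw [hxn] at h1; exact absurd h1 (by simp)
    · rcases step_branch p (i := 4 * (n / 4) + 1) (by omega) h1 with h2 | ⟨v, -, h2⟩
      · exact getVert_add_two_ne p hp (i := 4 * (n / 4)) (by omega) (by rw [h2, hE, hc₁E])
      · rw [show 4 * (n / 4) + 1 + 1 = n by omega, hxn] at h2; exact absurd h2 (by simp)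
    · rcases step_branch p (i := 4 * (n / 4) + 1) (by omega) h1 with h2 | ⟨v, -, h2⟩
      · exact getVert_add_two_ne p hp (i := 4 * (n / 4)) (by omega) (by rw [h2, hE, hc₁E])
      · obtain ⟨c₂, -, h3⟩ := step_vertex p (i := 4 * (n / 4) + 1 + 1) (by omega) h2
        rw [show 4 * (n / 4) + 1 + 1 + 1 = n by omega, hxn] at h3; exact absurd h3 (by simp)
  -- the label sequence along the edge-points
  let a : ℕ → Option β := fun m =>
    match p.getVert (4 * m) with
    | Sum.inr (Sum.inl E) => some (F E)
    | _ => none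
  have ha : ∀ (m : ℕ) (E : G.Edge), p.getVert (4 * m) = Sum.inr (Sum.inl E) → a m = some (F E) := by
    intro m E h; simp only [a, h]
  have h0 : a 0 = some (F e) := ha 0 e (by rw [Nat.mul_zero]; exact p.getVert_zero)
  have hN : a (n / 4) = some (F e') := ha (n / 4) e' (by rw [hn4]; exact p.getVert_length)
  obtain ⟨m, hm, hjump⟩ := exists_step_ne a (N := n / 4)
    (by rw [h0, hN]; exact fun h => hF (Option.some.inj h))
  -- the period starting at `4m`
  obtain ⟨E, hE⟩ := hedge m (by omega)
  obtain ⟨v, c₁, c₂, hc₁E, hc₁v, hc₂v, h1, h2, h3, h4⟩ :=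
    period_of_edge p hp (k := 4 * m) (by omega) hE
  have hE' : p.getVert (4 * (m + 1)) = Sum.inr (Sum.inl (G.edgeOf c₂)) := by
    rw [show 4 * (m + 1) = 4 * m + 4 by ring]; exact h4
  have hlab : F (G.edgeOf c₁) ≠ F (G.edgeOf c₂) := by
    intro hFF
    apply hjump
    rw [ha m E hE, ha (m + 1) (G.edgeOf c₂) hE', ← hc₁E, hFF]
  have hvs : (Sum.inl v : G.Node) ∈ p.support := by rw [← h2]; exact p.getVert_mem_support _
  have hc₁s : (Sum.inr (Sum.inr c₁) : G.Node) ∈ p.support := by rw [← h1]; exact p.getVert_mem_support _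
  have hc₂s : (Sum.inr (Sum.inr c₂) : G.Node) ∈ p.support := by rw [← h3]; exact p.getVert_mem_support _
  refine ⟨v, c₁, c₂, fun h => hlab (by rw [h]), hc₁v, hc₂v, hlab, fun γ => ⟨?_, ?_, ?_⟩⟩
  · simpa using fixV _ hvs γ
  · simpa using fixV _ hc₁s γ
  · simpa using fixV _ hc₂s γ

end SemiGraph

end Literature.AnabelianGeometry.SemiGraphs
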